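import Summits.Ventures.Crystal3D.Theorems.StickyWulffConstantTextureLiminfTexShadowLevelReachPlatesFluxAreaCell
import HarnessLib

/-!
# FLUX-TO-AREA with an explicit LOSS TERM for the inadmissible layers (one type per plate, any Hägg word; cf-p1 (cccxxxiv)(2) decision (C))
# (lane T, crux `TextureLiminfV5`, stmt-Ventures-23912, registered stub `stub_terraceCensus`; (β) assembly input (b) for GENERAL words)

HONEST FRAMING. Venture `Summits/Ventures/Crystal3D` (cell `crystal3d-full`), route `route-Ventures-StickyWulffConstant`, helper `--supports` the
law-v5 crux `TextureLiminfV5` (stmt-Ventures-23912), lane T, mechanism (β).  Pure bookkeeping on top of …LevelReachPlatesFluxArea{,Cell}; standard axioms;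
census-free, certificate-free; nothing about energies; F-C1 not moved.

THE POINT.  `plate_flux_ge_area` asks that EVERY layer of the window be `t`-admissible; cf-p1's decision (C) ((cccxxxiv)(2)) keeps ONE type per plate and
books the interior layers of opposite-sign runs as an EXPLICIT FLUX-LOSS TERM.  Here is that term, hypothesis-free: on the PROFITABLE window
`Kw⋆⋆ = {k ∈ Kw⋆ : n ≤ Φ·G_k}` every summand is `≥ 0`, the inadmissible ones (`σ(k−1) = σ k = −t`) are dropped, and each dropped summand is
`≤ Φ·G_k ≤ Φ·m ≤ 2.32·n·(ρ−4)` (`G_k ≤ m = (ρ−4)S`, `V ≤ n S`):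
* **`plate_flux_ge_area_loss`** — `√2·π·V·(ρ−4)² − 5·n·ρ − 2.32·n·(ρ−4)·#BAD ≤ flux_t(Kw⋆⋆)`, `BAD = {k ∈ Kw⋆⋆ : σ(k−1) = −t ∧ σ k = −t}`
  (zero for alternating words and for a run word of sign `t`; no admissibility hypothesis);
* **`bottomPlate_flux_ge_area_loss`** / **`topPlate_flux_ge_area_loss`** — the two cell instances (`V ≤ #RT·S`, `ν² ≤ 1` discharged as in …PlatesFluxAreaCell),
  `∃ Kw` form with the loss counted on that `Kw`.
WHAT THIS IS NOT: any bound on `#BAD` (a property of the word in the window — the assembly's «loss small enough» clause), the type-union census that would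
remove the loss; F-C1 not moved.
-/

noncomputable section

namespace Summit.Ventures.Crystal3D.Theorems

open Summit.Ventures.Crystal3D Finset
open Literature.MathematicalPhysics.StatisticalMechanics (basalMirror)
open Summit.Ventures.Crystal3D.Cruxes.TextureLiminf.TexShadow (E3)
open scoped InnerProductSpace

open scoped Classical in
/-- **FLUX-TO-AREA with the loss term** (abstract shape; see the module docstring). -/
theorem plate_flux_ge_area_loss (σ : ℤ → ℤ) (t : ℤ) (V ν ψ z ρ : ℝ) (n : ℕ)
    (hρ : 4 ≤ ρ) (hν : ν ^ 2 ≤ 1) (hV0 : 0 ≤ V) (hVS : V ≤ n * Real.sqrt (1 - ν ^ 2)) :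
    Real.sqrt 2 * Real.pi * V * (ρ - 4) ^ 2 - 5 * n * ρ -
        2.32 * n * (ρ - 4) *
          (((Finset.Icc ⌈(-((ρ - 4) * Real.sqrt (1 - ν ^ 2)) - (ψ - z * ν)) / Real.sqrt (2 / 3)⌉
              ⌊((ρ - 4) * Real.sqrt (1 - ν ^ 2) - (ψ - z * ν)) / Real.sqrt (2 / 3)⌋).filter (fun k : ℤ =>
              (n : ℝ) ≤ 4 * V / (Real.sqrt 3 * (1 - ν ^ 2)) *
                Real.sqrt (max 0 ((ρ - 4) ^ 2 * (1 - ν ^ 2) - ((k : ℝ) * Real.sqrt (2 / 3) + ψ - z * ν) ^ 2)) ∧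
              (σ (k - 1) = -t ∧ σ k = -t))).card : ℝ) ≤
      ∑ k ∈ (Finset.Icc ⌈(-((ρ - 4) * Real.sqrt (1 - ν ^ 2)) - (ψ - z * ν)) / Real.sqrt (2 / 3)⌉
          ⌊((ρ - 4) * Real.sqrt (1 - ν ^ 2) - (ψ - z * ν)) / Real.sqrt (2 / 3)⌋).filter (fun k : ℤ =>
            (n : ℝ) ≤ 4 * V / (Real.sqrt 3 * (1 - ν ^ 2)) *
              Real.sqrt (max 0 ((ρ - 4) ^ 2 * (1 - ν ^ 2) - ((k : ℝ) * Real.sqrt (2 / 3) + ψ - z * ν) ^ 2))),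
        (if ¬ (σ (k - 1) = -t ∧ σ k = -t) then (1 : ℝ) else 0) *
          (4 * V / (Real.sqrt 3 * (1 - ν ^ 2)) *
              Real.sqrt (max 0 ((ρ - 4) ^ 2 * (1 - ν ^ 2) - ((k : ℝ) * Real.sqrt (2 / 3) + ψ - z * ν) ^ 2)) -
            (n : ℝ)) := by
  set S : ℝ := Real.sqrt (1 - ν ^ 2) with hS
  set m : ℝ := (ρ - 4) * S with hm
  set K : Finset ℤ := Finset.Icc ⌈(-((ρ - 4) * Real.sqrt (1 - ν ^ 2)) - (ψ - z * ν)) / Real.sqrt (2 / 3)⌉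
      ⌊((ρ - 4) * Real.sqrt (1 - ν ^ 2) - (ψ - z * ν)) / Real.sqrt (2 / 3)⌋ with hK
  set Φ : ℝ := 4 * V / (Real.sqrt 3 * (1 - ν ^ 2)) with hΦ
  set G : ℤ → ℝ := fun k => Real.sqrt (max 0 ((ρ - 4) ^ 2 * (1 - ν ^ 2) - ((k : ℝ) * Real.sqrt (2 / 3) + ψ - z * ν) ^ 2)) with hGdef
  set f : ℤ → ℝ := fun k => Φ * G k - (n : ℝ) with hf
  set Kp : Finset ℤ := K.filter (fun k : ℤ => (n : ℝ) ≤ Φ * G k) with hKp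
  set Bad : Finset ℤ := K.filter (fun k : ℤ => (n : ℝ) ≤ Φ * G k ∧ (σ (k - 1) = -t ∧ σ k = -t)) with hBad
  have hS2 : 0 ≤ 1 - ν ^ 2 := by linarith
  have hS0 : 0 ≤ S := Real.sqrt_nonneg _
  have hSS : S ^ 2 = 1 - ν ^ 2 := by rw [hS, Real.sq_sqrt hS2]
  have hm0 : 0 ≤ m := mul_nonneg (by linarith) hS0
  have hΦ0 : 0 ≤ Φ := by rw [hΦ]; positivity
  have h3 : (1.73 : ℝ) ≤ Real.sqrt 3 := by
    rw [show (1.73 : ℝ) = Real.sqrt (1.73 ^ 2) by rw [Real.sqrt_sq (by norm_num)]]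
    exact Real.sqrt_le_sqrt (by norm_num)
  -- the core estimate on the whole window and the passage to the profitable window
  have hcore : Real.sqrt 2 * Real.pi * V * (ρ - 4) ^ 2 - 5 * n * ρ ≤ ∑ k ∈ K, f k := plate_window_core V ν ψ z ρ n hρ hν hV0 hVS
  have hprofit : ∑ k ∈ K, f k ≤ ∑ k ∈ Kp, f k := by
    rw [← Finset.sum_filter_add_sum_filter_not K (fun k : ℤ => (n : ℝ) ≤ Φ * G k) f]
    have hneg : ∑ k ∈ K.filter (fun k : ℤ => ¬ (n : ℝ) ≤ Φ * G k), f k ≤ 0 :=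
      Finset.sum_nonpos fun k hk => by have h := (Finset.mem_filter.1 hk).2; simp only [hf]; linarith [not_le.1 h]
    linarith
  -- each profile value is at most `m`, hence each summand at most `Φ m ≤ 2.32 n (ρ−4)`
  have hGle : ∀ k : ℤ, G k ≤ m := by
    intro k
    simp only [hGdef]
    calc Real.sqrt (max 0 ((ρ - 4) ^ 2 * (1 - ν ^ 2) - ((k : ℝ) * Real.sqrt (2 / 3) + ψ - z * ν) ^ 2))
        ≤ Real.sqrt (m ^ 2) := Real.sqrt_le_sqrt (max_le (sq_nonneg m) (by rw [hm, mul_pow, hSS]; nlinarith [sq_nonneg ((k : ℝ) * Real.sqrt (2 / 3) + ψ - z * ν)]))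
      _ = m := Real.sqrt_sq hm0
  have hΦm : Φ * m ≤ 2.32 * n * (ρ - 4) := by
    rcases eq_or_lt_of_le hS0 with h0 | hpos
    · have hm00 : m = 0 := by rw [hm, ← h0, mul_zero]
      rw [hm00, mul_zero]
      exact mul_nonneg (mul_nonneg (by norm_num) (Nat.cast_nonneg n)) (by linarith)
    · have hVS' : V / S ≤ n := by rw [div_le_iff₀ hpos]; exact hVS
      rw [show Φ * m = 4 / Real.sqrt 3 * (V / S) * (ρ - 4) by rw [hΦ, hm, ← hSS]; field_simp]
      have h43 : 4 / Real.sqrt 3 ≤ 2.32 := by rw [div_le_iff₀ (by positivity)]; linarith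
      have hρ4 : 0 ≤ ρ - 4 := by linarith
      have hVS0 : 0 ≤ V / S := div_nonneg hV0 hS0
      calc 4 / Real.sqrt 3 * (V / S) * (ρ - 4) ≤ 2.32 * (V / S) * (ρ - 4) := by gcongr
        _ ≤ 2.32 * n * (ρ - 4) := by gcongr
  have hfle : ∀ k : ℤ, f k ≤ 2.32 * n * (ρ - 4) := by
    intro k
    have := mul_le_mul_of_nonneg_left (hGle k) hΦ0
    simp only [hf]; linarith [Nat.cast_nonneg (α := ℝ) n]
  -- split the profitable window into admissible and BAD layers
  have hsplit : ∑ k ∈ Kp, (if ¬ (σ (k - 1) = -t ∧ σ k = -t) then (1 : ℝ) else 0) * f k =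
      ∑ k ∈ Kp, f k - ∑ k ∈ Kp.filter (fun k : ℤ => σ (k - 1) = -t ∧ σ k = -t), f k := by
    rw [← Finset.sum_filter_add_sum_filter_not Kp (fun k : ℤ => σ (k - 1) = -t ∧ σ k = -t) f,
      ← Finset.sum_filter_add_sum_filter_not Kp (fun k : ℤ => σ (k - 1) = -t ∧ σ k = -t)
        (fun k => (if ¬ (σ (k - 1) = -t ∧ σ k = -t) then (1 : ℝ) else 0) * f k)]
    have h1 : ∑ k ∈ Kp.filter (fun k : ℤ => σ (k - 1) = -t ∧ σ k = -t),
        (if ¬ (σ (k - 1) = -t ∧ σ k = -t) then (1 : ℝ) else 0) * f k = 0 :=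
      Finset.sum_eq_zero fun k hk => by rw [if_neg (not_not.2 (Finset.mem_filter.1 hk).2), zero_mul]
    have h2 : ∑ k ∈ Kp.filter (fun k : ℤ => ¬ (σ (k - 1) = -t ∧ σ k = -t)),
        (if ¬ (σ (k - 1) = -t ∧ σ k = -t) then (1 : ℝ) else 0) * f k =
        ∑ k ∈ Kp.filter (fun k : ℤ => ¬ (σ (k - 1) = -t ∧ σ k = -t)), f k :=
      Finset.sum_congr rfl fun k hk => by rw [if_pos (Finset.mem_filter.1 hk).2, one_mul]
    rw [h1, h2]; ring
  have hBadEq : Kp.filter (fun k : ℤ => σ (k - 1) = -t ∧ σ k = -t) = Bad := by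
    rw [hBad, hKp, Finset.filter_filter]
  have hloss : ∑ k ∈ Bad, f k ≤ 2.32 * n * (ρ - 4) * (Bad.card : ℝ) := by
    calc ∑ k ∈ Bad, f k ≤ ∑ _k ∈ Bad, 2.32 * n * (ρ - 4) := Finset.sum_le_sum fun k _ => hfle k
      _ = 2.32 * n * (ρ - 4) * (Bad.card : ℝ) := by rw [Finset.sum_const, nsmul_eq_mul]; ring
  rw [hsplit, hBadEq]
  linarith [hcore, hprofit, hloss]

open scoped Classical in
/-- **Bottom plate, loss form** (any Hägg word; one type `t`; loss = `2.32·#RT·(ρ−4)` per inadmissible profitable layer). -/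
theorem bottomPlate_flux_ge_area_loss (σ₁ : ℤ → ℤ) (L₁ : E3 ≃ₗᵢ[ℝ] E3) (s₁ : E3) (Fr : E3 ≃ₗᵢ[ℝ] E3) (t : ℤ)
    (hFr : (t = 1 ∧ Fr = L₁) ∨ (t = -1 ∧ Fr = basalMirror.trans L₁)) (R₀ ρ : ℝ) (hρ : 4 ≤ ρ) :
    ∃ Kw : Finset ℤ,
      Real.sqrt 2 * Real.pi * (∑ r ∈ inPlaneRoots Fr 1, (Fr r) 2) * (ρ - 4) ^ 2 - 5 * ((inPlaneRoots Fr 1).card : ℕ) * ρ -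
          2.32 * ((inPlaneRoots Fr 1).card : ℕ) * (ρ - 4) * ((Kw.filter fun k : ℤ => σ₁ (k - 1) = -t ∧ σ₁ k = -t).card : ℝ) ≤
      ∑ k ∈ Kw, (if ¬ (σ₁ (k - 1) = -t ∧ σ₁ k = -t) then (1 : ℝ) else 0) *
        (4 * (∑ r ∈ inPlaneRoots Fr 1, (Fr r) 2) / (Real.sqrt 3 * (1 - (L₁.symm (EuclideanSpace.single (2 : Fin 3) (1 : ℝ))) 2 ^ 2)) *
          Real.sqrt (max 0 ((ρ - 4) ^ 2 * (1 - (L₁.symm (EuclideanSpace.single (2 : Fin 3) (1 : ℝ))) 2 ^ 2) -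
            ((k : ℝ) * Real.sqrt (2 / 3) + (L₁.symm s₁) 2 -
              (-(R₀ + 1) - 1) * (L₁.symm (EuclideanSpace.single (2 : Fin 3) (1 : ℝ))) 2) ^ 2)) -
          ((inPlaneRoots Fr 1).card : ℝ)) := by
  obtain ⟨hV0, hVS⟩ := sum_inPlaneRoots_rise_le L₁ Fr (fun r hr => frame_apply_basal hFr hr)
  have h := plate_flux_ge_area_loss σ₁ t _ _ ((L₁.symm s₁) 2) (-(R₀ + 1) - 1) ρ _ hρ (symm_e₃_two_sq_le_one L₁) hV0 hVS
  refine ⟨_, le_trans (le_of_eq ?_) h⟩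
  rw [Finset.filter_filter]

open scoped Classical in
/-- **Top plate, loss form.** -/
theorem topPlate_flux_ge_area_loss (σ₂ : ℤ → ℤ) (L₂ : E3 ≃ₗᵢ[ℝ] E3) (s₂ : E3) (G₂ : E3 ≃ₗᵢ[ℝ] E3) (t' : ℤ)
    (hG₂ : (t' = 1 ∧ G₂ = L₂) ∨ (t' = -1 ∧ G₂ = basalMirror.trans L₂)) (R₀ h ρ : ℝ) (hρ : 4 ≤ ρ) :
    ∃ Kw : Finset ℤ,
      Real.sqrt 2 * Real.pi * (∑ r ∈ inPlaneRoots G₂ (-1), -(G₂ r) 2) * (ρ - 4) ^ 2 - 5 * ((inPlaneRoots G₂ (-1)).card : ℕ) * ρ -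
          2.32 * ((inPlaneRoots G₂ (-1)).card : ℕ) * (ρ - 4) * ((Kw.filter fun k : ℤ => σ₂ (k - 1) = -t' ∧ σ₂ k = -t').card : ℝ) ≤
      ∑ k ∈ Kw, (if ¬ (σ₂ (k - 1) = -t' ∧ σ₂ k = -t') then (1 : ℝ) else 0) *
        (4 * (∑ r ∈ inPlaneRoots G₂ (-1), -(G₂ r) 2) / (Real.sqrt 3 * (1 - (L₂.symm (EuclideanSpace.single (2 : Fin 3) (1 : ℝ))) 2 ^ 2)) *
          Real.sqrt (max 0 ((ρ - 4) ^ 2 * (1 - (L₂.symm (EuclideanSpace.single (2 : Fin 3) (1 : ℝ))) 2 ^ 2) -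
            ((k : ℝ) * Real.sqrt (2 / 3) + (L₂.symm s₂) 2 -
              (h + (R₀ + 1) + 1) * (L₂.symm (EuclideanSpace.single (2 : Fin 3) (1 : ℝ))) 2) ^ 2)) -
          ((inPlaneRoots G₂ (-1)).card : ℝ)) := by
  obtain ⟨hV0, hVS⟩ := sum_inPlaneRoots_fall_le L₂ G₂ (fun r hr => frame_apply_basal hG₂ hr)
  have h' := plate_flux_ge_area_loss σ₂ t' _ _ ((L₂.symm s₂) 2) (h + (R₀ + 1) + 1) ρ _ hρ (symm_e₃_two_sq_le_one L₂) hV0 hVS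
  refine ⟨_, le_trans (le_of_eq ?_) h'⟩
  rw [Finset.filter_filter]

end Summit.Ventures.Crystal3D.Theorems

end
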